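import Summits.RiemannHypothesis.RiemannHypothesis.Theorems.Splittings.NbCoefficientSign
import HarnessLib

/-!
# RH-EQUIVALENT·SPLITTING CENSUS (nb, neg) · V36 «SIGN», file 2/2: two-signs laws for arbitrary coefficients, real approximants (REAL ⟺ RH), and the dichotomy HALF-PLANE(u) ⟺ (Re u = 0 ∧ RH); nothing here bears on the truth of RH

LABEL (line 1): RH-EQUIVALENT·SPLITTING (cell `rh-split`, seat (nb, neg), generation 11, census
candidate V36, part A continued).  Referee carve (rh-split-ref g6) of the seat's kernel
`HOME/rh-split-nb-neg/g11/NbCoefficientSign.lean` sha16 2878432d80b8195b (620 l; farm rc 0, standard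
axioms) at its section boundary l. 343/344 for the gate's ≤ 400-line rule; declaration text
byte-verbatim, same namespace `…Splittings.NbCoefficientSign`; deltas = imports, this docstring.

## Contents (§§5–8 of part A; zero definitions, standard axioms, no zero of `ζ` used)

* §5 `nbNegMass_law` / `nbPosMass_law` — TWO-SIGNS LAW for ARBITRARY coefficients: every approximant
  with `I(N,a) ≤ i` carries weighted negative real mass `Σ_n max(-Re a_n, 0)(n+1)^{-2} ≥ 90/π⁴ - 6/π² - 50√i`
  and positive real mass `Σ_n max(Re a_n, 0)(n+1)^{-2} ≥ (6/π²)(1 - 24√i)`.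
* §6 `nbIntegrand_conj` / `nb_integral_conj` (conjugating `a` ↔ `t ↦ -t`), `nb_integral_midpoint_le`
  (convexity), `nb_lintegral_re_le : I(N, Re a) ≤ I(N,a)`, `nbRealApprox_iff_rh` — WLOG REAL coefficients:
  the real-coefficient criterion is RH-EQUIVALENT in kernel (⇐ via the tree's `nbConverse_holds'`).
* §7 `nbHalfPlaneApprox_of_rh` — the half-planes containing the real axis (`Re u = 0`) hold under RH.
* §8 `nbHalfPlaneApprox_iff (hu1 : ‖u‖ = 1) : HALF-PLANE(u) ⟺ (Re u = 0 ∧ RiemannHypothesis)` and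
  `nbUpperHalfPlaneApprox_iff_rh` — the V36 DICHOTOMY: every half-plane conjunct is REFUTED (file 1,
  `not_nbHalfPlaneApprox`, `Re u ≠ 0`) or RH-EQUIVALENT (`Re u = 0`); no unit `u` carries a live conjunct.

Print context as in file 1: Báez-Duarte, arXiv:math/0011254, Lemma 4.2 / Remark 4.7; Landreau–Richard,
Exp. Math. 11 (2002), p. 352.  Certifies nothing about RH.

HONEST LABEL: «SPLITTING SEARCH over kernel-typed RH-EQUIVALENCES; a splitting A ∧ B ⟹ RH is
CONDITIONAL bookkeeping unless A and B are both proved; nothing here bears on the truth of RH.»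
-/

set_option linter.dupNamespace false

noncomputable section

open Complex MeasureTheory Filter Topology
open scoped Real ComplexConjugate

namespace Summit.RiemannHypothesis.RiemannHypothesis.Theorems.Splittings.NbCoefficientSign

open Literature.NumberTheory.LFunctions
open Summit.RiemannHypothesis.RiemannHypothesis.Theorems.Splittings.NbBddNatural
open Summit.RiemannHypothesis.RiemannHypothesis.Theses.NymanBeurling

/-! ## 5. The two-signs law for arbitrary coefficients -/

/-- **NEGATIVE-MASS LAW (V36, zero-free).** For ANY coefficients with `I(N,a) ≤ i`, the
`(n+1)^{-2}`-weighted mass of the coefficients of negative real part is at least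
`90/π⁴ - 6/π² - 50√i` (`= 1/ζ(4) - 1/ζ(2) - 50√i ≈ 0.316 - 50√i`). -/
theorem nbNegMass_law {N : ℕ} (a : Fin N → ℂ) {i : ℝ} (hi : 0 ≤ i)
    (hI : ∫⁻ t : ℝ, ENNReal.ofReal (‖1 - riemannZeta (1 / 2 + t * Complex.I) *
        ∑ n : Fin N, a n * ((n : ℂ) + 1) ^ (-(1 / 2 + t * Complex.I))‖ ^ 2 / (1 / 4 + t ^ 2)) ≤
      ENNReal.ofReal i) :
    90 / π ^ 4 - 6 / π ^ 2 - 50 * Real.sqrt i ≤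
      ∑ n : Fin N, max (-(a n).re) 0 * (((n : ℝ) + 1) ^ (-(2 : ℝ))) := by
  obtain ⟨hz2l, hz2u, hz4l, hz4u⟩ := zeta_two_four_window
  have h2 := abs_re_sub_zeta_two_mul_le 1 norm_one a hi hI
  have h4 := abs_re_sub_zeta_four_mul_le 1 norm_one a hi hI
  simp only [one_mul, Complex.one_re] at h2 h4
  set z2 : ℝ := π ^ 2 / 6 with hz2
  set z4 : ℝ := π ^ 4 / 90 with hz4
  set s : ℝ := Real.sqrt i with hs
  set p2 : ℝ := (dirichletPoly a (2 : ℝ)).re with hp2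
  set p4 : ℝ := (dirichletPoly a (4 : ℝ)).re with hp4
  have hs0 : 0 ≤ s := Real.sqrt_nonneg i
  obtain ⟨h2a, h2b⟩ := abs_le.mp h2
  obtain ⟨h4a, h4b⟩ := abs_le.mp h4
  have hz2p : 0 < z2 := by linarith
  have hz4p : 0 < z4 := by linarith
  -- `p2 ≤ (1 + 24 s)/z2`, `p4 ≥ (1 - (800/21) s)/z4`
  have hp2le : p2 ≤ (1 + 24 * s) / z2 := by rw [le_div_iff₀ hz2p]; linarith
  have hp4ge : (1 - 800 / 21 * s) / z4 ≤ p4 := by rw [div_le_iff₀ hz4p]; linarith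
  -- the increase `p4 - p2` is carried by the negative coefficients
  have hinc : p4 - p2 ≤ ∑ n : Fin N, max (-(a n).re) 0 * (((n : ℝ) + 1) ^ (-(2 : ℝ))) := by
    have e2 : p2 = ∑ n : Fin N, (a n).re * (((n : ℝ) + 1) ^ (-(2 : ℝ))) := by
      have := re_mul_dirichletPoly_ofReal 1 a 2
      simp only [one_mul] at this
      exact this
    have e4 : p4 = ∑ n : Fin N, (a n).re * (((n : ℝ) + 1) ^ (-(4 : ℝ))) := by
      have := re_mul_dirichletPoly_ofReal 1 a 4
      simp only [one_mul] at this
      exact this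
    rw [e2, e4, ← Finset.sum_sub_distrib]
    refine Finset.sum_le_sum fun n _ ↦ ?_
    have ht : ((n : ℝ) + 1) ^ (-(4 : ℝ)) ≤ ((n : ℝ) + 1) ^ (-(2 : ℝ)) :=
      rpow_neg_antitone n (by norm_num)
    have ht0 : 0 ≤ ((n : ℝ) + 1) ^ (-(4 : ℝ)) := Real.rpow_nonneg (by positivity) _
    rcases le_or_gt 0 (a n).re with han | han
    · have : max (-(a n).re) 0 = 0 := max_eq_right (by linarith)
      rw [this, zero_mul]
      nlinarith [mul_le_mul_of_nonneg_left ht han]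
    · have : max (-(a n).re) 0 = -(a n).re := max_eq_left (by linarith)
      rw [this]
      nlinarith [mul_nonneg (le_of_lt (neg_pos.mpr han)) ht0]
  -- numerical assembly
  have hinv2 : 6 / π ^ 2 = 1 / z2 := by rw [hz2]; field_simp
  have hinv4 : 90 / π ^ 4 = 1 / z4 := by rw [hz4]; field_simp
  rw [hinv2, hinv4]
  have hA : 1 / z4 - 1 / z2 - 50 * s ≤ (1 - 800 / 21 * s) / z4 - (1 + 24 * s) / z2 := by
    rw [div_sub_div _ _ hz4p.ne' hz2p.ne', div_sub_div _ _ hz4p.ne' hz2p.ne',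
      sub_le_iff_le_add, div_add' _ _ _ (mul_pos hz4p hz2p).ne', div_le_div_iff_of_pos_right
      (mul_pos hz4p hz2p)]
    nlinarith [mul_pos hz4p hz2p, mul_nonneg hs0 hz4p.le, mul_nonneg hs0 hz2p.le]
  linarith

/-- **POSITIVE-MASS LAW (V36, zero-free).** For ANY coefficients with `I(N,a) ≤ i`, the
`(n+1)^{-2}`-weighted mass of the coefficients of positive real part is at least
`(6/π²)(1 - 24√i)` (`= (1 - 24√i)/ζ(2)`). -/
theorem nbPosMass_law {N : ℕ} (a : Fin N → ℂ) {i : ℝ} (hi : 0 ≤ i)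
    (hI : ∫⁻ t : ℝ, ENNReal.ofReal (‖1 - riemannZeta (1 / 2 + t * Complex.I) *
        ∑ n : Fin N, a n * ((n : ℂ) + 1) ^ (-(1 / 2 + t * Complex.I))‖ ^ 2 / (1 / 4 + t ^ 2)) ≤
      ENNReal.ofReal i) :
    6 / π ^ 2 * (1 - 24 * Real.sqrt i) ≤
      ∑ n : Fin N, max (a n).re 0 * (((n : ℝ) + 1) ^ (-(2 : ℝ))) := by
  obtain ⟨hz2l, hz2u, -, -⟩ := zeta_two_four_window
  have h2 := abs_re_sub_zeta_two_mul_le 1 norm_one a hi hI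
  simp only [one_mul, Complex.one_re] at h2
  set z2 : ℝ := π ^ 2 / 6 with hz2
  set s : ℝ := Real.sqrt i with hs
  set p2 : ℝ := (dirichletPoly a (2 : ℝ)).re with hp2
  obtain ⟨h2a, h2b⟩ := abs_le.mp h2
  have hz2p : 0 < z2 := by linarith
  have hp2ge : (1 - 24 * s) / z2 ≤ p2 := by rw [div_le_iff₀ hz2p]; linarith
  have hmass : p2 ≤ ∑ n : Fin N, max (a n).re 0 * (((n : ℝ) + 1) ^ (-(2 : ℝ))) := by
    have e2 : p2 = ∑ n : Fin N, (a n).re * (((n : ℝ) + 1) ^ (-(2 : ℝ))) := by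
      have := re_mul_dirichletPoly_ofReal 1 a 2
      simp only [one_mul] at this
      exact this
    rw [e2]
    refine Finset.sum_le_sum fun n _ ↦ ?_
    exact mul_le_mul_of_nonneg_right (le_max_left _ _) (Real.rpow_nonneg (by positivity) _)
  have hinv2 : 6 / π ^ 2 * (1 - 24 * s) = (1 - 24 * s) / z2 := by rw [hz2]; field_simp
  rw [hinv2]
  exact hp2ge.trans hmass

/-! ## 6. Conjugation symmetry of the Nyman–Beurling integral and real approximants -/

/-- `(n+1)^{-s̄}` is the conjugate of `(n+1)^{-s}`. -/
theorem natCast_add_one_cpow_neg_conj (n : ℕ) (s : ℂ) :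
    ((n : ℂ) + 1) ^ (-conj s) = conj (((n : ℂ) + 1) ^ (-s)) := by
  have harg : ((n : ℂ) + 1).arg ≠ π := by
    have : ((n : ℂ) + 1) = ((n + 1 : ℕ) : ℂ) := by push_cast; ring
    rw [this, Complex.natCast_arg]; exact Real.pi_pos.ne
  have hc : conj ((n : ℂ) + 1) = (n : ℂ) + 1 := by
    rw [map_add, map_one, Complex.conj_natCast]
  rw [← map_neg, Complex.cpow_conj _ _ harg, hc]

/-- The Dirichlet polynomial with conjugated coefficients: `A_{ā}(s) = conj (A_a(s̄))`. -/
theorem dirichletPoly_conj {N : ℕ} (a : Fin N → ℂ) (s : ℂ) :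
    ∑ n : Fin N, conj (a n) * ((n : ℂ) + 1) ^ (-s) =
      conj (∑ n : Fin N, a n * ((n : ℂ) + 1) ^ (-conj s)) := by
  rw [map_sum]
  refine Finset.sum_congr rfl fun n _ ↦ ?_
  rw [map_mul, ← natCast_add_one_cpow_neg_conj, conj_conj]

/-- **Conjugation symmetry of the integrand**: conjugating the coefficients reflects `t ↦ -t`. -/
theorem nbIntegrand_conj {N : ℕ} (a : Fin N → ℂ) (t : ℝ) :
    ‖1 - riemannZeta (1 / 2 + t * Complex.I) *
        ∑ n : Fin N, conj (a n) * ((n : ℂ) + 1) ^ (-(1 / 2 + t * Complex.I))‖ ^ 2 / (1 / 4 + t ^ 2) =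
      ‖1 - riemannZeta (1 / 2 + ↑(-t) * Complex.I) *
        ∑ n : Fin N, a n * ((n : ℂ) + 1) ^ (-(1 / 2 + ↑(-t) * Complex.I))‖ ^ 2 /
        (1 / 4 + (-t) ^ 2) := by
  have hs : (1 / 2 : ℂ) + t * Complex.I = conj (1 / 2 + ↑(-t) * Complex.I) := by
    apply Complex.ext <;> simp
  rw [hs, dirichletPoly_conj, conj_conj, riemannZeta_conj, ← map_mul, ← map_one (starRingEnd ℂ),
    ← map_sub, Complex.norm_conj, map_one, neg_sq]

/-- **Conjugation invariance of the Nyman–Beurling integral**: `I(N, ā) = I(N, a)`. -/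
theorem nb_integral_conj {N : ℕ} (a : Fin N → ℂ) :
    ∫ t : ℝ, ‖1 - riemannZeta (1 / 2 + t * Complex.I) *
        ∑ n : Fin N, conj (a n) * ((n : ℂ) + 1) ^ (-(1 / 2 + t * Complex.I))‖ ^ 2 / (1 / 4 + t ^ 2) =
      ∫ t : ℝ, ‖1 - riemannZeta (1 / 2 + t * Complex.I) *
        ∑ n : Fin N, a n * ((n : ℂ) + 1) ^ (-(1 / 2 + t * Complex.I))‖ ^ 2 / (1 / 4 + t ^ 2) := by
  simp_rw [nbIntegrand_conj]
  have h := MeasureTheory.Measure.integral_comp_mul_left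
    (fun t : ℝ ↦ ‖1 - riemannZeta (1 / 2 + t * Complex.I) *
        ∑ n : Fin N, a n * ((n : ℂ) + 1) ^ (-(1 / 2 + t * Complex.I))‖ ^ 2 / (1 / 4 + t ^ 2)) (-1)
  simp only [neg_one_mul, inv_neg, inv_one, abs_neg, abs_one, one_smul] at h
  simpa using h

/-- **Midpoint convexity of the integrand** in the coefficient vector. -/
theorem nbIntegrand_midpoint_le {N : ℕ} (a b : Fin N → ℂ) (t : ℝ) :
    ‖1 - riemannZeta (1 / 2 + t * Complex.I) *
        ∑ n : Fin N, (a n + b n) / 2 * ((n : ℂ) + 1) ^ (-(1 / 2 + t * Complex.I))‖ ^ 2 /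
        (1 / 4 + t ^ 2) ≤
      (‖1 - riemannZeta (1 / 2 + t * Complex.I) *
        ∑ n : Fin N, a n * ((n : ℂ) + 1) ^ (-(1 / 2 + t * Complex.I))‖ ^ 2 / (1 / 4 + t ^ 2) +
      ‖1 - riemannZeta (1 / 2 + t * Complex.I) *
        ∑ n : Fin N, b n * ((n : ℂ) + 1) ^ (-(1 / 2 + t * Complex.I))‖ ^ 2 / (1 / 4 + t ^ 2)) / 2 := by
  set s : ℂ := 1 / 2 + t * Complex.I with hsdef
  set p : ℂ := 1 - riemannZeta s * ∑ n : Fin N, a n * ((n : ℂ) + 1) ^ (-s) with hp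
  set q : ℂ := 1 - riemannZeta s * ∑ n : Fin N, b n * ((n : ℂ) + 1) ^ (-s) with hq
  have hsum : ∑ n : Fin N, (a n + b n) / 2 * ((n : ℂ) + 1) ^ (-s) =
      (∑ n : Fin N, a n * ((n : ℂ) + 1) ^ (-s) + ∑ n : Fin N, b n * ((n : ℂ) + 1) ^ (-s)) / 2 := by
    rw [← Finset.sum_add_distrib, Finset.sum_div]
    exact Finset.sum_congr rfl fun n _ ↦ by ring
  have hmid : 1 - riemannZeta s * ∑ n : Fin N, (a n + b n) / 2 * ((n : ℂ) + 1) ^ (-s) =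
      (p + q) / 2 := by rw [hsum, hp, hq]; ring
  rw [hmid, norm_div]
  have h2 : ‖(2 : ℂ)‖ = 2 := by norm_num
  rw [h2]
  have hw : 0 < 1 / 4 + t ^ 2 := by positivity
  rw [← add_div, div_div, div_le_div_iff₀ hw (by positivity)]
  have htri := norm_add_le p q
  have hp0 := norm_nonneg p
  have hq0 := norm_nonneg q
  have hpq0 := norm_nonneg (p + q)
  have key : (‖p + q‖ / 2) ^ 2 * 2 ≤ ‖p‖ ^ 2 + ‖q‖ ^ 2 := by
    nlinarith [sq_nonneg (‖p‖ - ‖q‖), mul_le_mul htri htri hpq0 (by linarith)]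
  nlinarith [key, hw]

/-- **Midpoint convexity of the Nyman–Beurling integral**: `I((a+b)/2) ≤ (I(a) + I(b))/2`
(Bochner form; the integrand is integrable for every coefficient vector). -/
theorem nb_integral_midpoint_le {N : ℕ} (a b : Fin N → ℂ) :
    ∫ t : ℝ, ‖1 - riemannZeta (1 / 2 + t * Complex.I) *
        ∑ n : Fin N, (a n + b n) / 2 * ((n : ℂ) + 1) ^ (-(1 / 2 + t * Complex.I))‖ ^ 2 /
        (1 / 4 + t ^ 2) ≤
      ((∫ t : ℝ, ‖1 - riemannZeta (1 / 2 + t * Complex.I) *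
        ∑ n : Fin N, a n * ((n : ℂ) + 1) ^ (-(1 / 2 + t * Complex.I))‖ ^ 2 / (1 / 4 + t ^ 2)) +
      ∫ t : ℝ, ‖1 - riemannZeta (1 / 2 + t * Complex.I) *
        ∑ n : Fin N, b n * ((n : ℂ) + 1) ^ (-(1 / 2 + t * Complex.I))‖ ^ 2 / (1 / 4 + t ^ 2)) / 2 := by
  rw [← integral_add (integrable_nbIntegrand a) (integrable_nbIntegrand b), ← integral_div]
  refine integral_mono (integrable_nbIntegrand _)
    (((integrable_nbIntegrand a).add (integrable_nbIntegrand b)).div_const 2) fun t ↦ ?_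
  exact nbIntegrand_midpoint_le a b t

/-- **Real parts do not increase the distance**: `I(N, Re a) ≤ I(N, a)` (Bochner form). -/
theorem nb_integral_re_le {N : ℕ} (a : Fin N → ℂ) :
    ∫ t : ℝ, ‖1 - riemannZeta (1 / 2 + t * Complex.I) *
        ∑ n : Fin N, ((a n).re : ℂ) * ((n : ℂ) + 1) ^ (-(1 / 2 + t * Complex.I))‖ ^ 2 /
        (1 / 4 + t ^ 2) ≤
      ∫ t : ℝ, ‖1 - riemannZeta (1 / 2 + t * Complex.I) *
        ∑ n : Fin N, a n * ((n : ℂ) + 1) ^ (-(1 / 2 + t * Complex.I))‖ ^ 2 / (1 / 4 + t ^ 2) := by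
  have h := nb_integral_midpoint_le a (fun n ↦ conj (a n))
  rw [nb_integral_conj a, add_self_div_two] at h
  have hre : ∀ n : Fin N, (a n + conj (a n)) / 2 = ((a n).re : ℂ) := fun n ↦ by
    rw [Complex.add_conj]; push_cast; ring
  simp_rw [hre] at h
  exact h

/-- **Real parts do not increase the distance** (`∫⁻` form of the route): `I(N, Re a) ≤ I(N, a)`. -/
theorem nb_lintegral_re_le {N : ℕ} (a : Fin N → ℂ) :
    ∫⁻ t : ℝ, ENNReal.ofReal (‖1 - riemannZeta (1 / 2 + t * Complex.I) *
        ∑ n : Fin N, ((a n).re : ℂ) * ((n : ℂ) + 1) ^ (-(1 / 2 + t * Complex.I))‖ ^ 2 /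
        (1 / 4 + t ^ 2)) ≤
      ∫⁻ t : ℝ, ENNReal.ofReal (‖1 - riemannZeta (1 / 2 + t * Complex.I) *
        ∑ n : Fin N, a n * ((n : ℂ) + 1) ^ (-(1 / 2 + t * Complex.I))‖ ^ 2 / (1 / 4 + t ^ 2)) := by
  rw [nb_lintegral_eq_ofReal_integral (fun n ↦ ((a n).re : ℂ)), nb_lintegral_eq_ofReal_integral a]
  exact ENNReal.ofReal_le_ofReal (nb_integral_re_le a)

/-- **RH ⟹ real approximants** (conjugation symmetry + convexity): under RH, for every `ε > 0`
some Dirichlet polynomial with REAL coefficients has `I(N,a) < ε`. -/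
theorem nbRealApprox_of_rh (hRH : Summit.RiemannHypothesis) :
    ∀ ε : ℝ, 0 < ε → ∃ (N : ℕ) (r : Fin N → ℝ),
      ∫⁻ t : ℝ, ENNReal.ofReal (‖1 - riemannZeta (1 / 2 + t * Complex.I) *
        ∑ n : Fin N, (r n : ℂ) * ((n : ℂ) + 1) ^ (-(1 / 2 + t * Complex.I))‖ ^ 2 / (1 / 4 + t ^ 2)) <
      ENNReal.ofReal ε := by
  intro ε hε
  obtain ⟨N, a, ha⟩ := nbConverse_holds' hRH ε hε
  exact ⟨N, fun n ↦ (a n).re, (nb_lintegral_re_le a).trans_lt ha⟩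

/-- **Real approximants ⟺ RH**: the Nyman–Beurling criterion with real coefficients. -/
theorem nbRealApprox_iff_rh :
    (∀ ε : ℝ, 0 < ε → ∃ (N : ℕ) (r : Fin N → ℝ),
      ∫⁻ t : ℝ, ENNReal.ofReal (‖1 - riemannZeta (1 / 2 + t * Complex.I) *
        ∑ n : Fin N, (r n : ℂ) * ((n : ℂ) + 1) ^ (-(1 / 2 + t * Complex.I))‖ ^ 2 / (1 / 4 + t ^ 2)) <
      ENNReal.ofReal ε) ↔ Summit.RiemannHypothesis := by
  refine ⟨fun h ↦ assembly_holds' fun ε hε ↦ ?_, nbRealApprox_of_rh⟩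
  obtain ⟨N, r, hr⟩ := h ε hε
  exact ⟨N, fun n ↦ (r n : ℂ), hr⟩

/-! ## 7. The half-planes containing the real axis: `u = ±I` -/

/-- Under RH, the half-planes `Re(u·z) ≥ 0` with `Re u = 0` (`u = ±I` when `‖u‖ = 1`) contain
approximants (the real ones): «HALF-PLANE(u)» holds. -/
theorem nbHalfPlaneApprox_of_rh (u : ℂ) (hure : u.re = 0) (hRH : Summit.RiemannHypothesis) :
    ∀ ε : ℝ, 0 < ε → ∃ (N : ℕ) (a : Fin N → ℂ), (∀ n, 0 ≤ (u * a n).re) ∧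
      ∫⁻ t : ℝ, ENNReal.ofReal (‖1 - riemannZeta (1 / 2 + t * Complex.I) *
        ∑ n : Fin N, a n * ((n : ℂ) + 1) ^ (-(1 / 2 + t * Complex.I))‖ ^ 2 / (1 / 4 + t ^ 2)) <
      ENNReal.ofReal ε := by
  intro ε hε
  obtain ⟨N, r, hr⟩ := nbRealApprox_of_rh hRH ε hε
  refine ⟨N, fun n ↦ (r n : ℂ), fun n ↦ ?_, hr⟩
  simp [Complex.mul_re, hure]

/-! ## 8. The V36 dichotomy: every half-plane conjunct is refuted or RH-equivalent -/

/-- **V36 DICHOTOMY (census row, kernel form).** For a unit `u`, the conjunct «HALF-PLANE(u)» —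
*for every `ε > 0` some Dirichlet polynomial with all coefficients in the closed half-plane
`Re(u·z) ≥ 0` has `I(N,a) < ε`* — holds IF AND ONLY IF `Re u = 0 ∧ RH`: for `Re u ≠ 0` it is
REFUTED outright (no zero of `ζ` used; effective floor `(Re u)²/27000`, `nbHalfPlane_floor`), for
`Re u = 0` (the two half-planes containing the real axis) it is RH-EQUIVALENT via real
approximants (`nbRealApprox_iff_rh`).  Either way «HALF-PLANE(u) ∧ B ⟹ RH» is no splitting:
refuted-conjunct or costume.  Nothing here bears on the truth of RH. -/
theorem nbHalfPlaneApprox_iff (u : ℂ) (hu1 : ‖u‖ = 1) :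
    (∀ ε : ℝ, 0 < ε → ∃ (N : ℕ) (a : Fin N → ℂ), (∀ n, 0 ≤ (u * a n).re) ∧
      ∫⁻ t : ℝ, ENNReal.ofReal (‖1 - riemannZeta (1 / 2 + t * Complex.I) *
        ∑ n : Fin N, a n * ((n : ℂ) + 1) ^ (-(1 / 2 + t * Complex.I))‖ ^ 2 / (1 / 4 + t ^ 2)) <
      ENNReal.ofReal ε) ↔ (u.re = 0 ∧ Summit.RiemannHypothesis) := by
  constructor
  · intro h
    by_cases hre : u.re = 0
    · exact ⟨hre, assembly_holds' (nbThesis_of_nbHalfPlaneApprox u h)⟩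
    · exact absurd h (not_nbHalfPlaneApprox u hu1 hre)
  · rintro ⟨hre, hRH⟩
    exact nbHalfPlaneApprox_of_rh u hre hRH

/-- **Upper half-plane ⟺ RH** (`u = -I`): approximants with all coefficients in the closed upper
half-plane `Im a_n ≥ 0` exist for every `ε` iff RH (they may be taken real).  The same holds for
the lower half-plane; the right and left half-planes are refuted (`not_nbPosReApprox`). -/
theorem nbUpperHalfPlaneApprox_iff_rh :
    (∀ ε : ℝ, 0 < ε → ∃ (N : ℕ) (a : Fin N → ℂ), (∀ n, 0 ≤ (a n).im) ∧
      ∫⁻ t : ℝ, ENNReal.ofReal (‖1 - riemannZeta (1 / 2 + t * Complex.I) *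
        ∑ n : Fin N, a n * ((n : ℂ) + 1) ^ (-(1 / 2 + t * Complex.I))‖ ^ 2 / (1 / 4 + t ^ 2)) <
      ENNReal.ofReal ε) ↔ Summit.RiemannHypothesis := by
  have h := nbHalfPlaneApprox_iff (-Complex.I) (by simp)
  have hkey : ∀ z : ℂ, (-Complex.I * z).re = z.im := fun z ↦ by simp
  simp only [hkey, Complex.neg_re, Complex.I_re, neg_zero, true_and] at h
  exact h

end Summit.RiemannHypothesis.RiemannHypothesis.Theorems.Splittings.NbCoefficientSign
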